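import Literature.Probability.RandomPlanarGeometry.SAWTriangularPolygonTallThird
import Literature.Probability.RandomPlanarGeometry.SAWTriangularPolygonJoinSpec
import HarnessLib

/-!
# Madras' join on `𝕋`: the domain of the join map and its size (S5𝕋, the counting half of `JoinMapSpecTri`)

Topic `Literature/Probability/RandomPlanarGeometry` (lane «pcv-sawmu», LINE «TRI-MADRAS»; continues
`SAWTriangularPolygonTallThird.lean` (`rowCount`, `IsYTall`, `sq_rowCount_ge`, `card_reps_le_three_mul_tall`) and
`SAWTriangularPolygonJoinSpec.lean` (`JoinMapSpecTri c K N`)).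

Source.  N. Madras, J. Stat. Phys. 78 (1995) 681–699 [Madras1995LatticeAnimalsExponent], §2 (two dimensions): a tall polygon
`ω` (height `≥ n^{1/2}`) and an arbitrary polygon `σ` can be joined after translating `σ` vertically to any of `≥ height(ω)`
relative positions; with at least a third of all polygons tall (here: `card_reps_le_three_mul_tall`, the `𝕋` edition of
Hammond's Lemma 4.9 [Hammond2015SAPJoining, arXiv:1504.05286v5 pp. 24–25]) the domain of the join map has
`≥ (1/3)·n^{1/2}·q_n²` elements.  This file fixes that DOMAIN and proves the count; the map and its injectivity are the other half.

## Contents (namespace `Literature.Probability.RandomPlanarGeometry.SAW.TriPolygon`)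
* `rows n ω`, `joinOffsets n ω σ` (the vertical offsets `τ` putting `σ`'s root row onto a row of `ω`; `#· = rowCount n ω`),
  `tallReps n`, `joinDomain n` (the `Σ`-type domain `{(ω, σ, τ)}`), `card_joinDomain`;
* `sqrt_le_rowCount` (`√(n+1) ≤ rowCount` for tall classes), **`card_joinDomain_ge`**: `(1/3)·√(n+1)·#Q[n+1]² ≤ #joinDomain n`;
* **`joinMapSpecTri_of_injOn`** — an injective map `joinDomain (N−1) → triPolygonReps (2N+K−1)` gives `JoinMapSpecTri (1/3) K N`.
-/

noncomputable section

open Finset Literature.Probability.LatticeModels Literature.Probability.Percolation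

namespace Literature.Probability.RandomPlanarGeometry.SAW

namespace TriPolygon

variable {n : ℕ} {ω σ : ℕ → Site 2}

open Classical in
/-- The rows visited by `ω` on `[0, n]`. [cite: Madras1995LatticeAnimalsExponent, §2 (height of a polygon)] -/
def rows (n : ℕ) (ω : ℕ → Site 2) : Finset ℤ := (range (n + 1)).image fun i => ω i 1

/-- `#rows = rowCount`. [cite: Madras1995LatticeAnimalsExponent, §2] -/
theorem card_rows (n : ℕ) (ω : ℕ → Site 2) : #(rows n ω) = rowCount n ω := rfl

/-- membership in `rows`. [cite: Madras1995LatticeAnimalsExponent, §2] -/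
theorem mem_rows {y : ℤ} : y ∈ rows n ω ↔ ∃ i, i ≤ n ∧ ω i 1 = y := by
  classical
  simp only [rows, Finset.mem_image, Finset.mem_range, Nat.lt_succ_iff]

open Classical in
/-- **Admissible vertical offsets**: `τ` such that the root row of `σ` translated by `τ` is a row of `ω` (then the translate of `σ`
meets the two-row neighbourhood of `ω`, so the sliding lemma applies). [cite: Madras1995LatticeAnimalsExponent, §2
("order `n^{1/2}` locations to which `φ'` may be translated and then attached to `φ`", as quoted by Hammond2015SAPJoining §4.1)] -/
def joinOffsets (n : ℕ) (ω σ : ℕ → Site 2) : Finset ℤ := (rows n ω).image fun y => y - σ 0 1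

/-- `#joinOffsets = rowCount ω`. [cite: Madras1995LatticeAnimalsExponent, §2] -/
theorem card_joinOffsets (n : ℕ) (ω σ : ℕ → Site 2) : #(joinOffsets n ω σ) = rowCount n ω := by
  classical
  rw [joinOffsets, Finset.card_image_of_injective _ (sub_left_injective), card_rows]

/-- membership in `joinOffsets`. [cite: Madras1995LatticeAnimalsExponent, §2] -/
theorem mem_joinOffsets {τ : ℤ} : τ ∈ joinOffsets n ω σ ↔ ∃ i, i ≤ n ∧ ω i 1 = σ 0 1 + τ := by
  classical
  simp only [joinOffsets, Finset.mem_image, mem_rows]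
  constructor
  · rintro ⟨y, ⟨i, hi, rfl⟩, rfl⟩; exact ⟨i, hi, by ring⟩
  · rintro ⟨i, hi, h⟩; exact ⟨ω i 1, ⟨i, hi, rfl⟩, by rw [h]; ring⟩

open Classical in
/-- The `Y`-tall canonical traversals. [cite: Madras1995LatticeAnimalsExponent, §2; Hammond2015SAPJoining, Definition 4.8 (arXiv v5 p. 24)] -/
def tallReps (n : ℕ) : Finset (ℕ → Site 2) := (triPolygonReps n).filter fun ω => IsYTall n ω

/-- membership in `tallReps`. [cite: Madras1995LatticeAnimalsExponent, §2] -/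
theorem mem_tallReps : ω ∈ tallReps n ↔ ω ∈ triPolygonReps n ∧ IsYTall n ω := by
  classical
  rw [tallReps, Finset.mem_filter]

/-- **The domain of the join map**: triples `(ω, σ, τ)` — a tall class, any class, an admissible offset.
[cite: Madras1995LatticeAnimalsExponent, §2; Hammond2015SAPJoining, §3.4 (arXiv v5 p. 12: "there are at least an order of `n^ν` locations to which `φ′` may be translated and then attached to `φ`")] -/
def joinDomain (n : ℕ) : Finset (Σ _ : (ℕ → Site 2) × (ℕ → Site 2), ℤ) :=
  (tallReps n ×ˢ triPolygonReps n).sigma fun x => joinOffsets n x.1 x.2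

/-- membership in `joinDomain`. [cite: Madras1995LatticeAnimalsExponent, §2] -/
theorem mem_joinDomain {x : Σ _ : (ℕ → Site 2) × (ℕ → Site 2), ℤ} :
    x ∈ joinDomain n ↔ x.1.1 ∈ tallReps n ∧ x.1.2 ∈ triPolygonReps n ∧ x.2 ∈ joinOffsets n x.1.1 x.1.2 := by
  rw [joinDomain, Finset.mem_sigma, Finset.mem_product, and_assoc]

/-- **Size of the domain**: `#joinDomain n = #Q[n+1] · Σ_{ω tall} rowCount ω`. [cite: Madras1995LatticeAnimalsExponent, §2] -/
theorem card_joinDomain (n : ℕ) :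
    #(joinDomain n) = #(triPolygonReps n) * ∑ ω ∈ tallReps n, rowCount n ω := by
  classical
  rw [joinDomain, Finset.card_sigma, Finset.sum_product]
  simp only [card_joinOffsets, Finset.sum_const, smul_eq_mul]
  rw [Finset.mul_sum]

/-- **A tall class has at least `√(n+1)` rows.** [cite: Madras1995LatticeAnimalsExponent, §2; Hammond2015SAPJoining, Definition 4.8 (arXiv v5 p. 24)] -/
theorem sqrt_le_rowCount (hω : ω ∈ tallReps n) : Real.sqrt (n + 1) ≤ (rowCount n ω : ℝ) := by
  obtain ⟨hr, ht⟩ := mem_tallReps.1 hω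
  have hs : ω ∈ brickSaws n := (mem_triPolygonReps.1 hr).1
  have h := sq_rowCount_ge hs ht
  have h' : ((n : ℝ) + 1) ≤ (rowCount n ω : ℝ) ^ 2 := by exact_mod_cast h
  calc Real.sqrt (n + 1) ≤ Real.sqrt ((rowCount n ω : ℝ) ^ 2) := Real.sqrt_le_sqrt h'
    _ = (rowCount n ω : ℝ) := Real.sqrt_sq (Nat.cast_nonneg _)

/-- **The domain is large**: `(1/3)·√(n+1)·#Q[n+1]² ≤ #joinDomain n`.
[cite: Madras1995LatticeAnimalsExponent, §2 (two dimensions: `p_{2n+K} ≥ c n^{1/2} p_n²`); Hammond2015SAPJoining, Lemma 4.9 (arXiv v5 pp. 24–25)] -/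
theorem card_joinDomain_ge (n : ℕ) :
    (1 / 3 : ℝ) * Real.sqrt (n + 1) * (#(triPolygonReps n) : ℝ) ^ 2 ≤ (#(joinDomain n) : ℝ) := by
  classical
  have hcard : (#(joinDomain n) : ℝ) = #(triPolygonReps n) * ∑ ω ∈ tallReps n, (rowCount n ω : ℝ) := by
    rw [card_joinDomain]; push_cast; rfl
  have hsum : (#(tallReps n) : ℝ) * Real.sqrt (n + 1) ≤ ∑ ω ∈ tallReps n, (rowCount n ω : ℝ) := by
    have h := Finset.card_nsmul_le_sum (tallReps n) (fun ω => (rowCount n ω : ℝ)) (Real.sqrt (n + 1))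
      (fun ω hω => sqrt_le_rowCount hω)
    rwa [nsmul_eq_mul] at h
  have htall : (#(triPolygonReps n) : ℝ) ≤ 3 * #(tallReps n) := by
    have h := card_reps_le_three_mul_tall n
    rw [← tallReps] at h
    exact_mod_cast h
  have hq : (0 : ℝ) ≤ #(triPolygonReps n) := Nat.cast_nonneg _
  have hs : (0 : ℝ) ≤ Real.sqrt (n + 1) := Real.sqrt_nonneg _
  calc (1 / 3 : ℝ) * Real.sqrt (n + 1) * (#(triPolygonReps n) : ℝ) ^ 2
      = #(triPolygonReps n) * ((#(triPolygonReps n) / 3) * Real.sqrt (n + 1)) := by ring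
    _ ≤ #(triPolygonReps n) * (#(tallReps n) * Real.sqrt (n + 1)) := by
        apply mul_le_mul_of_nonneg_left _ hq
        exact mul_le_mul_of_nonneg_right (by linarith) hs
    _ ≤ #(triPolygonReps n) * ∑ ω ∈ tallReps n, (rowCount n ω : ℝ) := mul_le_mul_of_nonneg_left hsum hq
    _ = (#(joinDomain n) : ℝ) := hcard.symm

end TriPolygon

/-- **From an injective join map on the domain to the specification**: any map `joinDomain (N−1) → triPolygonReps (2N+K−1)` that is
injective on the domain witnesses `JoinMapSpecTri (1/3) K N` (`N ≥ 1`).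
[cite: Madras1995LatticeAnimalsExponent, §2; Hammond2015SAPJoining, §4.1 (arXiv v5 pp. 17–20)] -/
theorem joinMapSpecTri_of_injOn {N K : ℕ} (hN : 1 ≤ N)
    (Ψ : (Σ _ : (ℕ → Site 2) × (ℕ → Site 2), ℤ) → (ℕ → Site 2))
    (hΨ : ∀ x ∈ TriPolygon.joinDomain (N - 1), Ψ x ∈ TriPolygon.triPolygonReps (2 * N + K - 1))
    (hinj : Set.InjOn Ψ ↑(TriPolygon.joinDomain (N - 1))) : JoinMapSpecTri (1 / 3) K N := by
  refine ⟨_, TriPolygon.joinDomain (N - 1), Ψ, ?_, hΨ, hinj⟩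
  have h := TriPolygon.card_joinDomain_ge (N - 1)
  have hN' : ((N - 1 : ℕ) : ℝ) + 1 = (N : ℝ) := by
    rw [Nat.cast_sub hN]; push_cast; ring
  rw [hN'] at h
  have hq : (triPolygonNumber N : ℝ) = #(TriPolygon.triPolygonReps (N - 1)) := by
    unfold triPolygonNumber; rfl
  rw [hq]
  exact h

end Literature.Probability.RandomPlanarGeometry.SAW
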